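import Summits.ABC.IUTFork.Joshi.TestGenuinePinsVacuityTame
import Summits.ABC.IUTFork.Thm311RealIsmDHMoverInitialThetaData
import HarnessLib

/-!
# Branch E TEST — the genuine-carrier pins are UNSATISFIABLE at EVERY ramified place over `p ≥ 5` and, for `F ∋ √−1`,
# at EVERY dyadic place — bad primes included (TEAM R's mover CENSUS fed into p445249's label-`0` criterion)

Proof-only sequel (abc-iut cell, block E, rung LADDER-ABC:A2.E; seat abc-iut-E-t44, gen 3; 0 definitions, no `Prop` fact) to this
seat's `Joshi/TestGenuinePinsVacuityTame.lean` (p446217) — the «one optional sequel» of abc-iut-E-cx g3's HANDOFF 2026-08-26T12:48:21Z and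
abc-iut-E-cx-2's INFO 1 on p445249 (12:38:20Z): abc-iut-w5-d039's mover CENSUS `Thm311RealIsmDHMoverCensus` /
`Thm311RealIsmDHMoverInitialThetaData` (consumed BY NAME) supplies a Dupuy–Hilado (Ind2) element moving the unit ball `𝒪_{v₀}`
(i) at EVERY ramified place `v₀` over a prime `p₀ ≥ 5` (`exists_mem_ismDH_image_closedBall_one_ne_of_five_le` — NO tameness, any
residue degree), and (ii) at EVERY place over `2` of EVERY `F ∋ √−1` (`…_of_exists_sq_eq_neg_one`; [IUTchI] Def. 3.1 (a): the field of
an initial Θ-datum contains `√−1`). Fed through abc-iut-w5-d044's dictionary `exists_ismDH_image_integers_ne_of_image_closedBall_ne` into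
p446217's `not_pinnedRegions_settingPrVolSharp_of_exists_mover_anyPrime` (p445249's single-slot label-`0` family: NO hypothesis on the
places of `S` over `p₀`):

* **`not_pinnedRegions(3)_settingPrVolSharp_of_ramified_five_le_anyPrime`** — `F` with ONE ramified place over some `p₀ ≥ 5`;
* **`not_pinnedRegions(3)_settingPrVolSharp_of_dyadic_of_sq_eq_neg_one`** — `F ∋ √−1`, ANY place `v₀ ∣ 2`:
for the analytic logarithms, `¬ Cor312Vol.PinnedRegions` / `¬ PinnedRegions3` at abc-iut-c312-7's `settingPrVolSharp` over
`LatticeSituation.ofShells (logShellsDH X (analyticLogv F)) …` for EVERY `X : PilotData F`, `ρ`, `qK`, column data, `Ψ`, ideles, column.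
Together with abc-iut-E-cx g3's p446117 (the same at `X := pilotDataOfK D L`, hypothesis-free via abc-iut-rp-s1's p442822) this closes
the census for general pilot data: the genuine-carrier clauses «(ii)(b)@n ∧ (pΘ) ∧ (pq′) ⟹ ¬S» (p430714 / p436213 / p438843) are VACUOUS
at every `F ∋ √−1` and at every `F` ramified over some `p ≥ 5`. SHARPNESS (census, positive side, not restated): no label-`0` mover exists
where all odd places are unramified (`forall_ismDH_image_closedBall_eq_of_unramified`). HONEST SCOPE: OUR interface, OUR sharp real
container, DH's reading of (Ind2); nothing bears on print's (xi-e)/(xi-f). [claim: Mochizuki2012, status: disputed]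
[cite: DupuyHilado2025, §4.9] [cite: Mochizuki2012, IUTchI Def. 3.1 (a)]
-/

noncomputable section

open Set Function NumberField IsDedekindDomain Metric
open scoped Pointwise

namespace Summit.ABC.IUTFork.Joshi

open Thm311 Thm311.Real Cor312 Cor312Vol Literature.IUT.LogThetaLattice Literature.IUT.LogVolume
  Literature.IUT.HodgeTheaters Literature.NumberTheory.NumberFields

variable {F : Type} [Field F] [NumberField F] (X : PilotData F)
  (M : Type) [Field M] [NumberField M]
  (archPk : ∀ (j : (thetaIndex X).Label) (vQ : (thetaIndex X).VQ), Set ((logShellsDH X (analyticLogv F)).Packet j vQ))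
  (archSub : ∀ (j : (thetaIndex X).Label) (v : (thetaIndex X).V),
    Set ((logShellsDH X (analyticLogv F)).Packet j ((thetaIndex X).over v)))
  (Ψ : ℤ → ∀ v : (thetaIndex X).V, v ∈ (thetaIndex X).Vbad → Set ((logShellsDH X (analyticLogv F)).StarPacket v))
  (act : ℤ → ∀ v : (thetaIndex X).V, v ∈ (thetaIndex X).Vbad →
    (logShellsDH X (analyticLogv F)).StarPacket v → Module.End ℚ ((logShellsDH X (analyticLogv F)).StarPacket v))
  (Mmod : ℤ → ∀ j : (thetaIndex X).LabelStar, Set ((logShellsDH X (analyticLogv F)).GlobalPacket j.1))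
  (region : ℤ → ∀ j : (thetaIndex X).LabelStar, FinDivisor M → ∀ vQ : (thetaIndex X).VQ,
    Set ((logShellsDH X (analyticLogv F)).Packet j.1 vQ))
  (frobAdm : ℤ → ℤ → ∀ (j : (thetaIndex X).Label) (vQ : (thetaIndex X).VQ),
    Set ((logShellsDH X (analyticLogv F)).Packet j vQ) → Prop)
  (frobLogvol : ℤ → ℤ → ∀ (j : (thetaIndex X).Label) (vQ : (thetaIndex X).VQ),
    Set ((logShellsDH X (analyticLogv F)).Packet j vQ) → ℝ)
  (frobΨ : ℤ → ℤ → ∀ v : (thetaIndex X).V, v ∈ (thetaIndex X).Vbad → Set ((logShellsDH X (analyticLogv F)).StarPacket v))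
  (frobMmod : ℤ → ℤ → ∀ j : (thetaIndex X).LabelStar, Set ((logShellsDH X (analyticLogv F)).GlobalPacket j.1))
  (unitImage : ℤ → ℤ → ℕ → ∀ (j : (thetaIndex X).Label) (vQ : (thetaIndex X).VQ),
    Set ((logShellsDH X (analyticLogv F)).Packet j vQ))
  (ballImage : ℤ → ℤ → ∀ (j : (thetaIndex X).Label) (vQ : (thetaIndex X).VQ),
    Set ((logShellsDH X (analyticLogv F)).Packet j vQ))
  (thetaDiv : ℤ → ℤ → LgpDivisor M (thetaIndex X).lstar)
  (n : ℤ) {HT : Type} {LogLink : HT → HT → Type} {IsFull : ∀ {s t : HT}, LogLink s t → Prop}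
  (lat : LGPGaussianLogThetaLattice LogLink IsFull)
  {Frd : Type} {IsoF : Frd → Frd → Type} {Ob : Frd → Type} {realify : Frd → Frd} {Strip : Type}
  {IsoS : Strip → Strip → Type} {Mv : ∀ v : (thetaIndex X).V, v ∈ (thetaIndex X).Vbad → Type}
  [∀ v h, Monoid (Mv v h)]
  (sig : GlobalLGPFrobenioidSignature (thetaIndex X).lstar (thetaIndex X).V (· ∈ (thetaIndex X).Vbad)
    Frd IsoF Ob realify Strip IsoS Mv)
  (split : SplittingMonoids Mv) {ObΔ : Type} {N : ∀ v : (thetaIndex X).V, v ∈ (thetaIndex X).Vbad → Type}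
  [∀ v h, Monoid (N v h)] (qData : QPilotData ObΔ N)
  (t : ∀ (pp : Nat.Primes) (_ : Fin X.lstar) (x : (thetaIndex X).Fibre (.inr pp)),
    haveI : Fact (pp : ℕ).Prime := ⟨pp.2⟩; kOf X pp.1 x)
  (tq : ∀ (pp : Nat.Primes) (x : (thetaIndex X).Fibre (.inr pp)), haveI : Fact (pp : ℕ).Prime := ⟨pp.2⟩; kOf X pp.1 x)
  (ρ : (∀ v : (thetaIndex X).V, v ∈ (thetaIndex X).Vbad → Set ((logShellsDH X (analyticLogv F)).StarPacket v)) →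
    ∀ (j : (thetaIndex X).Label) (vQ : (thetaIndex X).VQ), Set ((logShellsDH X (analyticLogv F)).Packet j vQ))
  (qK : ∀ v : (thetaIndex X).V, v ∈ (thetaIndex X).Vbad → Set ((logShellsDH X (analyticLogv F)).StarPacket v))
  (htq0 : ∀ pp x, tq pp x ≠ 0)
  (htq1 : ∀ (pp : Nat.Primes) (x : (thetaIndex X).Fibre (.inr pp)),
    haveI : Fact (pp : ℕ).Prime := ⟨pp.2⟩; placeOf X pp.1 x ∉ X.S → ‖tq pp x‖ = 1)


/-! ## 1. Every ramified place over `p ≥ 5` -/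

/-- **`F` RAMIFIED OVER SOME `p₀ ≥ 5` (any residue degree, tame or wild, places of `S` over `p₀` or not): `PinnedRegions` FAILS at
`settingPrVolSharp`** for the analytic logarithms — every `X : PilotData F`, `ρ`, `qK`, column data, `Ψ`, ideles, column. Mover:
abc-iut-w5-d039's `exists_mem_ismDH_image_closedBall_one_ne_of_five_le`. [cite: DupuyHilado2025, §4.9] [claim: Mochizuki2012, status: disputed] -/
theorem not_pinnedRegions_settingPrVolSharp_of_ramified_five_le_anyPrime (pp : Nat.Primes) (hp5 : 5 ≤ (pp : ℕ))
    (v₀ : HeightOneSpectrum (𝓞 F)) (hv₀ : (thetaIndex X).over (.inr v₀) = .inr pp) (he2 : 2 ≤ v₀.asIdeal.ramificationIdx ℤ) :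
    ¬ Cor312Vol.PinnedRegions
      (LatticeSituation.ofShells (logShellsDH X (analyticLogv F)) M archPk archSub
        (summandPiecesPr X (logvAnalytic_analyticLogv (F := F))).Adm
        (summandPiecesPr X (logvAnalytic_analyticLogv (F := F))).logvol Ψ act Mmod region frobAdm frobLogvol frobΨ frobMmod
        unitImage ballImage thetaDiv)
      (settingPrVolSharp X (logvAnalytic_analyticLogv (F := F)) M archPk archSub Ψ act Mmod region n lat sig split qData tq t
        htq0 htq1) ρ qK :=
  haveI : Fact (pp : ℕ).Prime := ⟨pp.2⟩
  not_pinnedRegions_settingPrVolSharp_of_exists_mover_anyPrime X M archPk archSub Ψ act Mmod region frobAdm frobLogvol frobΨ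
    frobMmod unitImage ballImage thetaDiv n lat sig split qData t tq ρ qK htq0 htq1 pp v₀ hv₀
    (exists_ismDH_image_integers_ne_of_image_closedBall_ne pp v₀ (natCast_mem_placeOf X pp ⟨.inr v₀, hv₀⟩)
      (exists_mem_ismDH_image_closedBall_one_ne_of_five_le (logvAnalyticAt_analyticLogv (F := F) (pp : ℕ)) v₀ _ hp5 he2))

/-- The same for `PinnedRegions3`. [claim: Mochizuki2012, status: disputed] -/
theorem not_pinnedRegions3_settingPrVolSharp_of_ramified_five_le_anyPrime (pp : Nat.Primes) (hp5 : 5 ≤ (pp : ℕ))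
    (v₀ : HeightOneSpectrum (𝓞 F)) (hv₀ : (thetaIndex X).over (.inr v₀) = .inr pp) (he2 : 2 ≤ v₀.asIdeal.ramificationIdx ℤ) :
    ¬ Cor312Vol.PinnedRegions3
      (LatticeSituation.ofShells (logShellsDH X (analyticLogv F)) M archPk archSub
        (summandPiecesPr X (logvAnalytic_analyticLogv (F := F))).Adm
        (summandPiecesPr X (logvAnalytic_analyticLogv (F := F))).logvol Ψ act Mmod region frobAdm frobLogvol frobΨ frobMmod
        unitImage ballImage thetaDiv)
      (settingPrVolSharp X (logvAnalytic_analyticLogv (F := F)) M archPk archSub Ψ act Mmod region n lat sig split qData tq t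
        htq0 htq1) ρ qK :=
  fun h => not_pinnedRegions_settingPrVolSharp_of_ramified_five_le_anyPrime X M archPk archSub Ψ act Mmod region frobAdm
    frobLogvol frobΨ frobMmod unitImage ballImage thetaDiv n lat sig split qData t tq ρ qK htq0 htq1 pp hp5 v₀ hv₀ he2 h.1

/-! ## 2. `F ∋ √−1`: every dyadic place -/

/-- **`F ∋ √−1` (e.g. the field of any initial Θ-datum, [IUTchI] Def. 3.1 (a)), ANY place `v₀ ∣ 2`: `PinnedRegions` FAILS at
`settingPrVolSharp`** for the analytic logarithms — every `X : PilotData F`, `ρ`, `qK`, column data, `Ψ`, ideles, column. Mover: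
abc-iut-w5-d039's `exists_mem_ismDH_image_closedBall_one_ne_of_exists_sq_eq_neg_one`.
[cite: Mochizuki2012, IUTchI Def. 3.1 (a)] [cite: DupuyHilado2025, §4.9] [claim: Mochizuki2012, status: disputed] -/
theorem not_pinnedRegions_settingPrVolSharp_of_dyadic_of_sq_eq_neg_one (hF : ∃ i : F, i ^ 2 = -1)
    (v₀ : HeightOneSpectrum (𝓞 F)) (hv₀ : (thetaIndex X).over (.inr v₀) = .inr ⟨2, Nat.prime_two⟩) :
    ¬ Cor312Vol.PinnedRegions
      (LatticeSituation.ofShells (logShellsDH X (analyticLogv F)) M archPk archSub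
        (summandPiecesPr X (logvAnalytic_analyticLogv (F := F))).Adm
        (summandPiecesPr X (logvAnalytic_analyticLogv (F := F))).logvol Ψ act Mmod region frobAdm frobLogvol frobΨ frobMmod
        unitImage ballImage thetaDiv)
      (settingPrVolSharp X (logvAnalytic_analyticLogv (F := F)) M archPk archSub Ψ act Mmod region n lat sig split qData tq t
        htq0 htq1) ρ qK :=
  haveI : Fact (Nat.Prime 2) := ⟨Nat.prime_two⟩
  not_pinnedRegions_settingPrVolSharp_of_exists_mover_anyPrime X M archPk archSub Ψ act Mmod region frobAdm frobLogvol frobΨ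
    frobMmod unitImage ballImage thetaDiv n lat sig split qData t tq ρ qK htq0 htq1 ⟨2, Nat.prime_two⟩ v₀ hv₀
    (exists_ismDH_image_integers_ne_of_image_closedBall_ne ⟨2, Nat.prime_two⟩ v₀
      (natCast_mem_placeOf X (⟨2, Nat.prime_two⟩ : Nat.Primes) ⟨.inr v₀, hv₀⟩)
      (exists_mem_ismDH_image_closedBall_one_ne_of_exists_sq_eq_neg_one (logvAnalyticAt_analyticLogv (F := F) 2) v₀ _ rfl
        hF))

/-- The same for `PinnedRegions3`. [claim: Mochizuki2012, status: disputed] -/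
theorem not_pinnedRegions3_settingPrVolSharp_of_dyadic_of_sq_eq_neg_one (hF : ∃ i : F, i ^ 2 = -1)
    (v₀ : HeightOneSpectrum (𝓞 F)) (hv₀ : (thetaIndex X).over (.inr v₀) = .inr ⟨2, Nat.prime_two⟩) :
    ¬ Cor312Vol.PinnedRegions3
      (LatticeSituation.ofShells (logShellsDH X (analyticLogv F)) M archPk archSub
        (summandPiecesPr X (logvAnalytic_analyticLogv (F := F))).Adm
        (summandPiecesPr X (logvAnalytic_analyticLogv (F := F))).logvol Ψ act Mmod region frobAdm frobLogvol frobΨ frobMmod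
        unitImage ballImage thetaDiv)
      (settingPrVolSharp X (logvAnalytic_analyticLogv (F := F)) M archPk archSub Ψ act Mmod region n lat sig split qData tq t
        htq0 htq1) ρ qK :=
  fun h => not_pinnedRegions_settingPrVolSharp_of_dyadic_of_sq_eq_neg_one X M archPk archSub Ψ act Mmod region frobAdm frobLogvol
    frobΨ frobMmod unitImage ballImage thetaDiv n lat sig split qData t tq ρ qK htq0 htq1 hF v₀ hv₀ h.1

end Summit.ABC.IUTFork.Joshi

end
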